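import Summits.AtomisticToContinuum.Crystallization.Theorems.FreeSplittingCertificatesRadiusLadderHalfRuleIff

/-!
# `FiniteRangeSplitting` (stmt-AtomisticToContinuum-12559): the small-radius rungs have ONE sharp hard-core threshold

Support file for crux r2 of route `FreeSplittingCertificates` (block-2b unit `b2b-freesplit-A`, gen 12).
VALUE = a structural theorem about the crux's instances — NOT summit progress.

`…RadiusLadderHalfRuleIff` showed that for `0 < R < δ` the rung `RungAt δ R` is the deepest-site inequality
`HalfSumFeasible δ`, whose truth set is an up-set in `δ`.  Here that up-set gets its threshold

  `halfSumThreshold := sInf {δ | HalfSumFeasible δ}`  (a real number, `23/25 ≤ δ_½ ≤ 4/3` by `…RadiusLadderHalfRule`),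

with the sharp dichotomy: `HalfSumFeasible δ` for every `δ > δ_½` and `¬ HalfSumFeasible δ` for every `δ < δ_½`
(`halfSumFeasible_of_threshold_lt`, `not_halfSumFeasible_of_lt_threshold`); read back on the crux: for `δ > δ_½` EVERY radius is
a rung (`rungAt_of_threshold_lt`), for `0 < δ < δ_½` NO radius `R < δ` is (`not_rungAt_of_lt_threshold`) — there every witness of
`∃ R > 0, RungAt δ R` must read patterns of radius `R ≥ δ`.  Certificates move the bracket through `le_halfSumThreshold_of_not` /
`halfSumThreshold_le_of`: each refuting star (`Star959`: `23/25`; `Star392`: `93/100`, …) is a lower bound, each feasibility proof of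
the half rule an upper bound.  (Whether `δ_½` itself is feasible is left open, as it must be.)
-/

noncomputable section

namespace Summit.AtomisticToContinuum.Crystallization.Theorems.StrictSplittingRuleBirth

open scoped BigOperators Classical
open Literature.MathematicalPhysics.StatisticalMechanics

/-- The hard-core threshold of the deepest-site inequality: `δ_½ = inf {δ | HalfSumFeasible δ}`. [folklore] -/
def halfSumThreshold : ℝ := sInf {δ : ℝ | HalfSumFeasible δ}

/-- The truth set is nonempty (`4/3` is in it). [folklore] -/
theorem halfSumFeasible_set_nonempty : ({δ : ℝ | HalfSumFeasible δ}).Nonempty :=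
  ⟨4 / 3, halfSumFeasible_of_four_thirds_le le_rfl⟩

/-- The truth set is bounded below (by `23/25`). [folklore] -/
theorem halfSumFeasible_set_bddBelow : BddBelow {δ : ℝ | HalfSumFeasible δ} :=
  ⟨23 / 25, fun _ hδ => le_of_lt (not_le.mp fun h => not_halfSumFeasible_of_le_23_25 h hδ)⟩

/-- A refuted hard core is a LOWER bound for the threshold. [folklore] -/
theorem le_halfSumThreshold_of_not {c : ℝ} (hc : ¬ HalfSumFeasible c) : c ≤ halfSumThreshold :=
  le_csInf halfSumFeasible_set_nonempty fun _ hδ =>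
    le_of_lt (not_le.mp fun h => hc (halfSumFeasible_mono h hδ))

/-- A feasible hard core is an UPPER bound for the threshold. [folklore] -/
theorem halfSumThreshold_le_of {c : ℝ} (hc : HalfSumFeasible c) : halfSumThreshold ≤ c :=
  csInf_le halfSumFeasible_set_bddBelow hc

/-- **Above the threshold the deepest-site inequality holds.** [folklore] -/
theorem halfSumFeasible_of_threshold_lt {δ : ℝ} (h : halfSumThreshold < δ) : HalfSumFeasible δ := by
  obtain ⟨s, hs, hsδ⟩ := (csInf_lt_iff halfSumFeasible_set_bddBelow halfSumFeasible_set_nonempty).mp h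
  exact halfSumFeasible_mono hsδ.le hs

/-- **Below the threshold it fails.** [folklore] -/
theorem not_halfSumFeasible_of_lt_threshold {δ : ℝ} (h : δ < halfSumThreshold) : ¬ HalfSumFeasible δ :=
  fun hδ => absurd (halfSumThreshold_le_of hδ) (not_le.mpr h)

/-- The current bracket from the tree's certificates: `23/25 ≤ δ_½ ≤ 4/3` (`Star959`; the layer-cake bound). [folklore] -/
theorem halfSumThreshold_mem_Icc : halfSumThreshold ∈ Set.Icc (23 / 25 : ℝ) (4 / 3) :=
  ⟨le_halfSumThreshold_of_not (not_halfSumFeasible_of_le_23_25 le_rfl),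
    halfSumThreshold_le_of (halfSumFeasible_of_four_thirds_le le_rfl)⟩

/-! ## Read back on the crux `∀ δ > 0, ∃ R > 0, RungAt δ R` -/

/-- Above the threshold EVERY radius is a rung (witness: the half rule). -/
theorem rungAt_of_threshold_lt {δ : ℝ} (h : halfSumThreshold < δ) (R : ℝ) : RungAt δ R :=
  rungAt_of_halfSumFeasible (halfSumFeasible_of_threshold_lt h) R

/-- … so the crux's `δ`-instance holds there. -/
theorem exists_rung_of_threshold_lt {δ : ℝ} (h : halfSumThreshold < δ) : ∃ R : ℝ, 0 < R ∧ RungAt δ R :=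
  ⟨1, one_pos, rungAt_of_threshold_lt h 1⟩

/-- Below the threshold NO sub-separation radius is a rung: every witness must have `R ≥ δ`. -/
theorem not_rungAt_of_lt_threshold {δ R : ℝ} (hδ : 0 < δ) (h : δ < halfSumThreshold) (hR : R < δ) : ¬ RungAt δ R :=
  fun hr => not_halfSumFeasible_of_lt_threshold h (halfSumFeasible_of_rungAt hδ hR hr)

/-- **Dichotomy of the small-radius rungs**: for `0 < R < δ` and `δ ≠ δ_½`, `RungAt δ R ↔ δ_½ < δ`. -/
theorem rungAt_iff_threshold_lt {δ R : ℝ} (hδ : 0 < δ) (hR : R < δ) (hne : δ ≠ halfSumThreshold) :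
    RungAt δ R ↔ halfSumThreshold < δ := by
  refine ⟨fun hr => ?_, fun h => rungAt_of_threshold_lt h R⟩
  rcases lt_or_gt_of_ne hne with hlt | hgt
  · exact absurd hr (not_rungAt_of_lt_threshold hδ hlt hR)
  · exact hgt

end Summit.AtomisticToContinuum.Crystallization.Theorems.StrictSplittingRuleBirth

end
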